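import Summits.BirchSwinnertonDyer.BirchSwinnertonDyer.Theorems.ErratumRoadFiveRest3LocusFromKolyvaginSharp
import HarnessLib

/-!
# Route `ErratumRoadFive` (rung K2, `p ≥ 5`), crux `Rest3NoWitnessBranchAtFive` (item stmt-BirchSwinnertonDyer-19703, the
# no-witness branch (NW) of REST‴): its registered Locus stub `stub_nw_locus` is CONDITIONAL-CLOSED on the Kolyvagin
# hypothesis `hZα` (as the parent's `stub_rest3_locus`, p447940), and its Tamagawa stub `stub_nw_offLocus` together with
# the torsion branch (T) IS the parent's REST⁗ — bookkeeping across the three registered skeletons 19624 ∕ 19702 ∕ 19703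

Cell `bsd-stepL` (run/shared/lean/pub/bsd-stepL/), seat `bsd-stepL-rest-p2` (prover g0, 2026-08-26);
`--supports stmt-BirchSwinnertonDyer-19703 --as helper`. Planner g25 split crux 19624 (REST‴) into (T) 19702 and (NW) 19703
BY NAME over this seat's defs (p446621) and registered for (NW) the BC3 skeleton `plan/SPLIT19624/Lines-birth-19703.lean`
(stubs `stub_nw_locus` = (NW) ∧ `p ∤ ∏ c_ℓ`, `stub_nw_offLocus` = (NW) ∧ `p ∣ ∏ c_ℓ`, plan-only rungs `stub_rung_nw_5015b1`
— signature IDENTICAL to the parent's `stub_rung_rest3_5015b1`, hence concluded by the landed `rung_5015b1_of_cert`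
(p449825) — and `stub_rung_nw_5595f1`).

What this file proves (THEOREMS ONLY; pure composition over p447940 and p446621; no definition, no named fact, no `sorry`):
* §1 `nwLocus_of_rest3Locus` ∕ `rest3Locus_of_nwLocus` — the Locus stubs of 19624 and 19703 are EQUIVALENT statements
  (on `p ∤ ∏ c_ℓ` the torsion clause is automatic at the crux's binders); hence **`nwLocus_of_kolyvaginSharpAlpha`** and
  the by-name **`nwLocus_of_publishedInputsFive_of_kolyvaginSharpAlpha`** ∕ `…_of_kolyvaginFramesHL`: the registered
  statement of `stub_nw_locus` VERBATIM from the published facts + `hrec` + `hMc` + `h36` + JSW331-mult + `hZα` (resp.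
  `hZ₅`) — CONDITIONAL-CLOSED on Skinner–Zhang Thm. 1.3 (PREPRINT), exactly like the parent's Locus piece.
* §2 `rest3Tam_of_torsionBranch_of_nwOffLocus` ∕ `nwOffLocus_of_rest3Tam` (with p447940's `rest3TorsionBranchAtFive_of_rest3Tam`) — the parent's
  registered Tamagawa stub `stub_rest3_tam` (REST⁗, cw 22 480) ⟺ (T) (crux 19702, cw 3 687) ∧ `stub_nw_offLocus`
  (cw 18 793): the three registered skeletons cut the same set, and a proof of any two of {REST⁗, (T), NW-off-Locus}
  gives the third.

HONEST FRAMING: CONDITIONAL on every displayed binder; `hZα` ∕ `hZ₅` are conjecture-shaped hypotheses (SZ14 Thm. 1.3,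
unrefereed); nothing is booked; every stub stays OPEN unconditionally; BSD is proved for no pair; no census word moves (T7).

References: [SkinnerZhang2014] Thm. 1.3; [McCallumLMS1991] §5 Cor. 5.6; [Darmon2004] Thm. 3.6; [JetchevSkinnerWan2017]
Thm. 3.3.1; [Castella2018Erratum] Thm. 1.1 (iii)–(iv); [SilvermanATAEC1994] Cor. IV.9.2(d).
-/

set_option autoImplicit false
-- the Theorems namespace of this sub repeats the summit name by design (D-0017 nested layout)
set_option linter.dupNamespace false

noncomputable section

open scoped Classical

open WeierstrassCurve Literature.NumberTheory.EllipticCurves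
  Literature.NumberTheory.EllipticCurves.ModularForms
  Literature.NumberTheory.EllipticCurves.Rank1Residual
  Summit.BirchSwinnertonDyer.Rank1Residual Summit.BirchSwinnertonDyer.Rank1Residual.X11b
  Summit.BirchSwinnertonDyer.BirchSwinnertonDyer.Theses.ErratumRoadFive

namespace Summit.BirchSwinnertonDyer.BirchSwinnertonDyer.Theorems

/-! ## §1 The Locus stubs of 19624 and 19703 are the same statement; `stub_nw_locus` from `hZα` -/

/-- **`stub_nw_locus` ⟸ `stub_rest3_locus`** (pure logic: the (NW) hypotheses «torsion-free ∧ no odd non-split witness»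
imply REST‴'s hypothesis «¬(witness ∧ torsion-free)»). [folklore] -/
theorem nwLocus_of_rest3Locus
    (h : ∀ (W : WeierstrassCurve ℚ) [W.IsElliptic] [W.IsGloballyMinimal] (p : ℕ) [Fact p.Prime],
      Literature.NumberTheory.EllipticCurves.Rank1Residual.Ram W p →
      ¬ ((∃ (q : ℕ) (_ : Fact q.Prime), q ≠ 2 ∧ q ≠ p ∧ Literature.NumberTheory.EllipticCurves.Rank1Residual.Mult W q ∧
          ¬ W.HasSplitMultiplicativeReductionAtPrime q ∧ ¬ p ∣ padicValInt q W.minimalDiscriminantInt) ∧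
        (∀ P : (W.baseChange ℚ_[p]).toAffine.Point, p • P = 0 → P = 0)) →
      ¬ p ∣ W.tamagawaProduct →
      Summit.BirchSwinnertonDyer.Rank1Residual.X11b.P2OpenInputOnTreeAt W p) :
    ∀ (W : WeierstrassCurve ℚ) [W.IsElliptic] [W.IsGloballyMinimal] (p : ℕ) [Fact p.Prime],
      Literature.NumberTheory.EllipticCurves.Rank1Residual.Ram W p →
      (∀ P : (W.baseChange ℚ_[p]).toAffine.Point, p • P = 0 → P = 0) →
      ¬ (∃ (q : ℕ) (_ : Fact q.Prime), q ≠ 2 ∧ q ≠ p ∧ Literature.NumberTheory.EllipticCurves.Rank1Residual.Mult W q ∧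
          ¬ W.HasSplitMultiplicativeReductionAtPrime q ∧ ¬ p ∣ padicValInt q W.minimalDiscriminantInt) →
      ¬ p ∣ W.tamagawaProduct →
      Summit.BirchSwinnertonDyer.Rank1Residual.X11b.P2OpenInputOnTreeAt W p :=
  fun W _ _ p _ hram _ hno htam ↦ h W p hram (fun hh ↦ hno hh.1) htam

/-- **`stub_rest3_locus` ⟸ `stub_nw_locus`** (on `p ∤ ∏ c_ℓ`, at the crux's binders `ClassX11b ∧ 5 ≤ p`, the pair is
torsion-free at `p` by `LocalTorsion.localTorsion_eq_zero_of_not_dvd_tamagawaProduct`, so the REST‴ hypothesis there is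
the no-witness clause). So the two registered Locus stubs are EQUIVALENT. [cite: SilvermanATAEC1994, Cor. IV.9.2(d) with (b) (PDF p. 340)] -/
theorem rest3Locus_of_nwLocus
    (h : ∀ (W : WeierstrassCurve ℚ) [W.IsElliptic] [W.IsGloballyMinimal] (p : ℕ) [Fact p.Prime],
      Literature.NumberTheory.EllipticCurves.Rank1Residual.Ram W p →
      (∀ P : (W.baseChange ℚ_[p]).toAffine.Point, p • P = 0 → P = 0) →
      ¬ (∃ (q : ℕ) (_ : Fact q.Prime), q ≠ 2 ∧ q ≠ p ∧ Literature.NumberTheory.EllipticCurves.Rank1Residual.Mult W q ∧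
          ¬ W.HasSplitMultiplicativeReductionAtPrime q ∧ ¬ p ∣ padicValInt q W.minimalDiscriminantInt) →
      ¬ p ∣ W.tamagawaProduct →
      Summit.BirchSwinnertonDyer.Rank1Residual.X11b.P2OpenInputOnTreeAt W p) :
    ∀ (W : WeierstrassCurve ℚ) [W.IsElliptic] [W.IsGloballyMinimal] (p : ℕ) [Fact p.Prime],
      Literature.NumberTheory.EllipticCurves.Rank1Residual.Ram W p →
      ¬ ((∃ (q : ℕ) (_ : Fact q.Prime), q ≠ 2 ∧ q ≠ p ∧ Literature.NumberTheory.EllipticCurves.Rank1Residual.Mult W q ∧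
          ¬ W.HasSplitMultiplicativeReductionAtPrime q ∧ ¬ p ∣ padicValInt q W.minimalDiscriminantInt) ∧
        (∀ P : (W.baseChange ℚ_[p]).toAffine.Point, p • P = 0 → P = 0)) →
      ¬ p ∣ W.tamagawaProduct →
      Summit.BirchSwinnertonDyer.Rank1Residual.X11b.P2OpenInputOnTreeAt W p := by
  intro W _ _ p _ hram hno htam
  refine p2OpenInputOnTreeAt_of_imp_surj W p fun hX hp5 _ ↦ ?_
  have hiv : ∀ Q : (W.baseChange ℚ_[p]).toAffine.Point, p • Q = 0 → Q = 0 :=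
    LocalTorsion.localTorsion_eq_zero_of_not_dvd_tamagawaProduct W p (le_trans (by norm_num) hp5) hX.2.2.1 htam
  exact h W p hram hiv (fun hq ↦ hno ⟨hq, hiv⟩) htam

/-- **`stub_nw_locus` (registered signature VERBATIM) ⟸ the Kolyvagin road at `p ≥ 5`, kernel form**: published named
facts + `hrec` + `hMc` + `h36` + JSW331-mult + `hZα` (imc-p1 g5's binder verbatim: Kolyvagin's conjecture mod `p`, ∀-frame ♯,
on the (α) ∩ Locus pairs at Hoffstein–Luo fields) — p447940's `rest3Locus_of_kolyvaginSharpAlpha` through §1. CONDITIONAL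
(SZ14 Thm. 1.3 is a PREPRINT); nothing booked. [cite: SkinnerZhang2014, Thm. 1.3 (arXiv:1407.1099 §1) (shape of `hZα`)]
[cite: McCallumLMS1991, §5 Cor. 5.6 (p. 310)] [cite: Darmon2004, Thm. 3.6] [cite: JetchevSkinnerWan2017, Thm. 3.3.1 and §7.4.1] -/
theorem nwLocus_of_kolyvaginSharpAlpha
    (hGZ : ∀ (N : ℕ) [NeZero N] (W : WeierstrassCurve ℚ) (K : Type) [Field K] [NumberField K],
      gross_zagier N W K)
    (hKo : ∀ (N : ℕ) [NeZero N] (W : WeierstrassCurve ℚ) (K : Type) [Field K] [NumberField K],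
      kolyvagin N W K)
    (hB : ∀ (N : ℕ) [NeZero N] (W : WeierstrassCurve ℚ) (K : Type) [Field K] [NumberField K],
      Kolyvagin1990_padicValNat_card_sha_le N W K)
    (hSk : Skinner2016.thmC_padicValRat_bsd_rank_zero)
    (hGZK : rank_eq_analyticRank_of_analyticRank_le_one) (hmod : hasEntireLFunction_rat)
    (hnf : exists_isNewformOf) (hHL : HoffsteinLuo1997_exists_twist_L_one_ne_zero)
    (hMaz : mazur_not_dvd_maninConstant_of_odd)
    (hrec : ∀ (N : ℕ) [NeZero N] (W : WeierstrassCurve ℚ) (K : Type) [Field K] [NumberField K],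
      heegnerPointOfConductor_one_galoisConj N W K)
    (hMc : McCallum1991_pow_dvd_card_sha_primary_of_certificate)
    (h36 : ∀ (N : ℕ) [NeZero N] (W : WeierstrassCurve ℚ) (K : Type) [Field K] [NumberField K],
      phi_heegnerTau_mem_range_map_singularModuliField N W K)
    (h331 : JetchevSkinnerWan2017.thm331_anticyclotomicControl_mult)
    (hZα : ∀ (W : WeierstrassCurve ℚ) [W.IsElliptic] [W.IsGloballyMinimal] [NeZero (W.conductorNorm ℤ)]
      (p : ℕ) [hp : Fact p.Prime] (K : Type) [Field K] [NumberField K]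
      (Dt : ModularParametrizationData W (W.conductorNorm ℤ)) (β : ℤ) (ι : K →+* ℂ),
      ClassX11b W p → 5 ≤ p → W.HasMultiplicativeReductionAtPrime p → Rank1Residual.Surj W p →
      Rank1Residual.Ram W p → ¬ p ∣ W.tamagawaProduct →
      (∀ (q : ℕ) [Fact q.Prime], q ≠ 2 → q ≠ p → Rank1Residual.Mult W q →
        ¬ W.HasSplitMultiplicativeReductionAtPrime q → p ∣ padicValInt q W.minimalDiscriminantInt) →
      IsImaginaryQuadratic K → Odd (NumberField.discr K) →
      SatisfiesHeegnerHypothesis (W.conductorNorm ℤ) K →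
      (W.quadraticTwist (NumberField.discr K : ℚ)).entireLFunction 1 ≠ 0 →
      NumberField.discr K ≠ -3 →
      (4 * (W.conductorNorm ℤ : ℤ)) ∣ β ^ 2 - NumberField.discr K → ¬ (p : ℤ) ∣ Dt.c →
      ∃ (n : ℕ) (d : KolyvaginHeegnerData Dt β ι n),
        KolyvaginDescent.KolSupp (Zhang2014.IsKolyvaginPrime (W.conductorNorm ℤ) W K p) n ∧
          d.kolyvaginClass hp.out 1 ≠ 0) :
    ∀ (W : WeierstrassCurve ℚ) [W.IsElliptic] [W.IsGloballyMinimal] (p : ℕ) [Fact p.Prime],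
      Literature.NumberTheory.EllipticCurves.Rank1Residual.Ram W p →
      (∀ P : (W.baseChange ℚ_[p]).toAffine.Point, p • P = 0 → P = 0) →
      ¬ (∃ (q : ℕ) (_ : Fact q.Prime), q ≠ 2 ∧ q ≠ p ∧ Literature.NumberTheory.EllipticCurves.Rank1Residual.Mult W q ∧
          ¬ W.HasSplitMultiplicativeReductionAtPrime q ∧ ¬ p ∣ padicValInt q W.minimalDiscriminantInt) →
      ¬ p ∣ W.tamagawaProduct →
      Summit.BirchSwinnertonDyer.Rank1Residual.X11b.P2OpenInputOnTreeAt W p :=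
  nwLocus_of_rest3Locus
    (rest3Locus_of_kolyvaginSharpAlpha hGZ hKo hB hSk hGZK hmod hnf hHL hMaz hrec hMc h36 h331 hZα)

/-- **`stub_nw_locus` BY THE ROUTE'S NAMES ⟸ `hZα`**: `PublishedInputsFive` (19066) + `JSWAnticyclotomicControlMult` (19626) +
`hrec` + `hMc` + `h36` + `hZα`. CONDITIONAL; nothing booked. [cite: SkinnerZhang2014, Thm. 1.3 (shape of `hZα`)]
[cite: McCallumLMS1991, §5 Cor. 5.6 (p. 310)] [cite: Darmon2004, Thm. 3.6] [cite: JetchevSkinnerWan2017, Thm. 3.3.1] -/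
theorem nwLocus_of_publishedInputsFive_of_kolyvaginSharpAlpha
    (hF : PublishedInputsFive) (h331 : JSWAnticyclotomicControlMult)
    (hrec : ∀ (N : ℕ) [NeZero N] (W : WeierstrassCurve ℚ) (K : Type) [Field K] [NumberField K],
      heegnerPointOfConductor_one_galoisConj N W K)
    (hMc : McCallum1991_pow_dvd_card_sha_primary_of_certificate)
    (h36 : ∀ (N : ℕ) [NeZero N] (W : WeierstrassCurve ℚ) (K : Type) [Field K] [NumberField K],
      phi_heegnerTau_mem_range_map_singularModuliField N W K)
    (hZα : ∀ (W : WeierstrassCurve ℚ) [W.IsElliptic] [W.IsGloballyMinimal] [NeZero (W.conductorNorm ℤ)]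
      (p : ℕ) [hp : Fact p.Prime] (K : Type) [Field K] [NumberField K]
      (Dt : ModularParametrizationData W (W.conductorNorm ℤ)) (β : ℤ) (ι : K →+* ℂ),
      ClassX11b W p → 5 ≤ p → W.HasMultiplicativeReductionAtPrime p → Rank1Residual.Surj W p →
      Rank1Residual.Ram W p → ¬ p ∣ W.tamagawaProduct →
      (∀ (q : ℕ) [Fact q.Prime], q ≠ 2 → q ≠ p → Rank1Residual.Mult W q →
        ¬ W.HasSplitMultiplicativeReductionAtPrime q → p ∣ padicValInt q W.minimalDiscriminantInt) →
      IsImaginaryQuadratic K → Odd (NumberField.discr K) →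
      SatisfiesHeegnerHypothesis (W.conductorNorm ℤ) K →
      (W.quadraticTwist (NumberField.discr K : ℚ)).entireLFunction 1 ≠ 0 →
      NumberField.discr K ≠ -3 →
      (4 * (W.conductorNorm ℤ : ℤ)) ∣ β ^ 2 - NumberField.discr K → ¬ (p : ℤ) ∣ Dt.c →
      ∃ (n : ℕ) (d : KolyvaginHeegnerData Dt β ι n),
        KolyvaginDescent.KolSupp (Zhang2014.IsKolyvaginPrime (W.conductorNorm ℤ) W K p) n ∧
          d.kolyvaginClass hp.out 1 ≠ 0) :
    ∀ (W : WeierstrassCurve ℚ) [W.IsElliptic] [W.IsGloballyMinimal] (p : ℕ) [Fact p.Prime],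
      Literature.NumberTheory.EllipticCurves.Rank1Residual.Ram W p →
      (∀ P : (W.baseChange ℚ_[p]).toAffine.Point, p • P = 0 → P = 0) →
      ¬ (∃ (q : ℕ) (_ : Fact q.Prime), q ≠ 2 ∧ q ≠ p ∧ Literature.NumberTheory.EllipticCurves.Rank1Residual.Mult W q ∧
          ¬ W.HasSplitMultiplicativeReductionAtPrime q ∧ ¬ p ∣ padicValInt q W.minimalDiscriminantInt) →
      ¬ p ∣ W.tamagawaProduct →
      Summit.BirchSwinnertonDyer.Rank1Residual.X11b.P2OpenInputOnTreeAt W p :=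
  nwLocus_of_rest3Locus (rest3Locus_of_publishedInputsFive_of_kolyvaginSharpAlpha hF h331 hrec hMc h36 hZα)

/-- **`stub_nw_locus` BY THE ROUTE'S NAMES ⟸ the Locus-wide Kolyvagin hypothesis `hZ₅`** (KOLY's crux shape at `p ≥ 5`).
CONDITIONAL; nothing booked. [cite: SkinnerZhang2014, Thm. 1.3 (shape of `hZ₅`)] [cite: McCallumLMS1991, §5 Cor. 5.6 (p. 310)]
[cite: Darmon2004, Thm. 3.6] [cite: JetchevSkinnerWan2017, Thm. 3.3.1] -/
theorem nwLocus_of_publishedInputsFive_of_kolyvaginFramesHL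
    (hF : PublishedInputsFive) (h331 : JSWAnticyclotomicControlMult)
    (hrec : ∀ (N : ℕ) [NeZero N] (W : WeierstrassCurve ℚ) (K : Type) [Field K] [NumberField K],
      heegnerPointOfConductor_one_galoisConj N W K)
    (hMc : McCallum1991_pow_dvd_card_sha_primary_of_certificate)
    (h36 : ∀ (N : ℕ) [NeZero N] (W : WeierstrassCurve ℚ) (K : Type) [Field K] [NumberField K],
      phi_heegnerTau_mem_range_map_singularModuliField N W K)
    (hZ₅ : ∀ (W : WeierstrassCurve ℚ) [W.IsElliptic] [W.IsGloballyMinimal] [NeZero (W.conductorNorm ℤ)]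
      (p : ℕ) [hp : Fact p.Prime] (K : Type) [Field K] [NumberField K]
      (Dt : ModularParametrizationData W (W.conductorNorm ℤ)) (β : ℤ) (ι : K →+* ℂ),
      ClassX11b W p → 5 ≤ p → W.HasMultiplicativeReductionAtPrime p → Rank1Residual.Surj W p →
      Rank1Residual.Ram W p → ¬ p ∣ W.tamagawaProduct →
      IsImaginaryQuadratic K → Odd (NumberField.discr K) →
      SatisfiesHeegnerHypothesis (W.conductorNorm ℤ) K →
      (W.quadraticTwist (NumberField.discr K : ℚ)).entireLFunction 1 ≠ 0 →
      NumberField.discr K ≠ -3 →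
      (4 * (W.conductorNorm ℤ : ℤ)) ∣ β ^ 2 - NumberField.discr K → ¬ (p : ℤ) ∣ Dt.c →
      ∃ (n : ℕ) (d : KolyvaginHeegnerData Dt β ι n),
        KolyvaginDescent.KolSupp (Zhang2014.IsKolyvaginPrime (W.conductorNorm ℤ) W K p) n ∧
          d.kolyvaginClass hp.out 1 ≠ 0) :
    ∀ (W : WeierstrassCurve ℚ) [W.IsElliptic] [W.IsGloballyMinimal] (p : ℕ) [Fact p.Prime],
      Literature.NumberTheory.EllipticCurves.Rank1Residual.Ram W p →
      (∀ P : (W.baseChange ℚ_[p]).toAffine.Point, p • P = 0 → P = 0) →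
      ¬ (∃ (q : ℕ) (_ : Fact q.Prime), q ≠ 2 ∧ q ≠ p ∧ Literature.NumberTheory.EllipticCurves.Rank1Residual.Mult W q ∧
          ¬ W.HasSplitMultiplicativeReductionAtPrime q ∧ ¬ p ∣ padicValInt q W.minimalDiscriminantInt) →
      ¬ p ∣ W.tamagawaProduct →
      Summit.BirchSwinnertonDyer.Rank1Residual.X11b.P2OpenInputOnTreeAt W p :=
  nwLocus_of_rest3Locus (rest3Locus_of_publishedInputsFive_of_kolyvaginFramesHL hF h331 hrec hMc h36 hZ₅)

/-! ## §2 REST⁗ (`stub_rest3_tam`) = (T) + `stub_nw_offLocus`: the three skeletons cut the same set -/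

/-- **REST⁗ ⟸ (T) + `stub_nw_offLocus`** (case split on the torsion clause at a `p ∣ ∏ c_ℓ` pair). Bookkeeping only.
[folklore] -/
theorem rest3Tam_of_torsionBranch_of_nwOffLocus (hT : Rest3TorsionBranchAtFive)
    (hN : ∀ (W : WeierstrassCurve ℚ) [W.IsElliptic] [W.IsGloballyMinimal] (p : ℕ) [Fact p.Prime],
      Literature.NumberTheory.EllipticCurves.Rank1Residual.Ram W p →
      (∀ P : (W.baseChange ℚ_[p]).toAffine.Point, p • P = 0 → P = 0) →
      ¬ (∃ (q : ℕ) (_ : Fact q.Prime), q ≠ 2 ∧ q ≠ p ∧ Literature.NumberTheory.EllipticCurves.Rank1Residual.Mult W q ∧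
          ¬ W.HasSplitMultiplicativeReductionAtPrime q ∧ ¬ p ∣ padicValInt q W.minimalDiscriminantInt) →
      p ∣ W.tamagawaProduct →
      Summit.BirchSwinnertonDyer.Rank1Residual.X11b.P2OpenInputOnTreeAt W p) :
    ∀ (W : WeierstrassCurve ℚ) [W.IsElliptic] [W.IsGloballyMinimal] (p : ℕ) [Fact p.Prime],
      Literature.NumberTheory.EllipticCurves.Rank1Residual.Ram W p →
      ¬ ((∃ (q : ℕ) (_ : Fact q.Prime), q ≠ 2 ∧ q ≠ p ∧ Literature.NumberTheory.EllipticCurves.Rank1Residual.Mult W q ∧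
          ¬ W.HasSplitMultiplicativeReductionAtPrime q ∧ ¬ p ∣ padicValInt q W.minimalDiscriminantInt) ∧
        (∀ P : (W.baseChange ℚ_[p]).toAffine.Point, p • P = 0 → P = 0)) →
      p ∣ W.tamagawaProduct →
      Summit.BirchSwinnertonDyer.Rank1Residual.X11b.P2OpenInputOnTreeAt W p := by
  intro W _ _ p _ hram hno htam
  by_cases htors : ∀ P : (W.baseChange ℚ_[p]).toAffine.Point, p • P = 0 → P = 0
  · exact hN W p hram htors (fun hq ↦ hno ⟨hq, htors⟩) htam
  · have hex : ∃ P : (W.baseChange ℚ_[p]).toAffine.Point, p • P = 0 ∧ P ≠ 0 := by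
      push Not at htors
      exact htors
    -- `Rest3TorsionBranchAtFive` (the route def) unfolds to the Theses-free constant
    exact (show Summit.BirchSwinnertonDyer.BirchSwinnertonDyer.Theorems.Rest3TorsionBranchAtFive from hT) W p hram hex

/-- **`stub_nw_offLocus` ⟸ REST⁗** (a restriction). Bookkeeping only. [folklore] -/
theorem nwOffLocus_of_rest3Tam
    (h : ∀ (W : WeierstrassCurve ℚ) [W.IsElliptic] [W.IsGloballyMinimal] (p : ℕ) [Fact p.Prime],
      Literature.NumberTheory.EllipticCurves.Rank1Residual.Ram W p →
      ¬ ((∃ (q : ℕ) (_ : Fact q.Prime), q ≠ 2 ∧ q ≠ p ∧ Literature.NumberTheory.EllipticCurves.Rank1Residual.Mult W q ∧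
          ¬ W.HasSplitMultiplicativeReductionAtPrime q ∧ ¬ p ∣ padicValInt q W.minimalDiscriminantInt) ∧
        (∀ P : (W.baseChange ℚ_[p]).toAffine.Point, p • P = 0 → P = 0)) →
      p ∣ W.tamagawaProduct →
      Summit.BirchSwinnertonDyer.Rank1Residual.X11b.P2OpenInputOnTreeAt W p) :
    ∀ (W : WeierstrassCurve ℚ) [W.IsElliptic] [W.IsGloballyMinimal] (p : ℕ) [Fact p.Prime],
      Literature.NumberTheory.EllipticCurves.Rank1Residual.Ram W p →
      (∀ P : (W.baseChange ℚ_[p]).toAffine.Point, p • P = 0 → P = 0) →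
      ¬ (∃ (q : ℕ) (_ : Fact q.Prime), q ≠ 2 ∧ q ≠ p ∧ Literature.NumberTheory.EllipticCurves.Rank1Residual.Mult W q ∧
          ¬ W.HasSplitMultiplicativeReductionAtPrime q ∧ ¬ p ∣ padicValInt q W.minimalDiscriminantInt) →
      p ∣ W.tamagawaProduct →
      Summit.BirchSwinnertonDyer.Rank1Residual.X11b.P2OpenInputOnTreeAt W p :=
  fun W _ _ p _ hram _ hno htam ↦ h W p hram (fun hh ↦ hno hh.1) htam

end Summit.BirchSwinnertonDyer.BirchSwinnertonDyer.Theorems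

end
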